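import Literature.Analysis.FluidPDE.ESSFarFieldVorticityHalfSpaceFrame
import Literature.Analysis.FluidPDE.LocalLerayBackwardUniquenessAnyDatum
import Mathlib.Analysis.SpecialFunctions.SmoothTransition
import HarnessLib

/-!
# Backward uniqueness for local Leray solutions on a slab from ONE HALF-SPACE of the final value
# (Lemarié-Rieusset 2016, Thm. 15.4, with the final value vanishing only on `{x₃ > R₁}`)

Analysis/FluidPDE proof file (theorems only: no definition, no named fact, no `sorry`).

The tree proves Lemarié-Rieusset's backward uniqueness theorem for slab local Leray solutions with
the final value vanishing everywhere (`…_anyDatum`) and, since this lead's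
`LocalLerayBackwardUniquenessFarField.lean`, outside a ball. Escauriaza–Seregin–Šverák's backward
uniqueness for the vorticity is a HALF-SPACE theorem (Thm. 5.1), and the only consumer of the
far-field vorticity in the 15.4 route (`ae_zero_strip_of_farField_curl_eq_zero`) needs
`curl = 0` only on a half-space `{x₃ > R}`. Hence:

* `localLeray_farField_curl_eq_zero_slab_of_halfSpace_vanishing` — if the pairings of a slab
  local Leray solution `u` with the test fields supported in the half-space `{x₃ > R₁}` tend to
  `0` as `t ↑ T₁`, then a representative of `u` has vanishing vorticity on
  `(T₄, T₁) × {x₃ > R}`. Proof: the far-field representative `U` of the tree on the exterior of a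
  large ball (`exists_farField_representative`, `farField_bound_anyDatum`), restricted to the
  half-space `{x₃ > R}`, `R ≥ R₁ + 1`; the half-space frame theorem
  `farField_curl_eq_zero_halfSpace_of_frame` (direction `e₃`) applied to the cut-off field
  `σ(x₃) u`, `σ` a smooth step (`Real.smoothTransition`) equal to `1` on `{x₃ ≥ R}` and to `0` on
  `{x₃ ≤ R − 1/2}`: it agrees with `U` a.e. on the half-space region and its pairings with EVERY
  test field tend to `0`.
* `IsLocalLeraySolutionOn.ae_zero_of_halfSpace_final_vanishing_unit` — **Thm. 15.4 from one
  half-space of the final value** (unit viscosity): a slab local Leray solution with weakly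
  divergence-free datum whose pairings with the test fields supported in `{x₃ > R₁}` tend to `0`
  as `t ↑ T` vanishes a.e. Word for word the tree's assembly (CKN regular times, bounded strips,
  `ae_zero_strip_of_farField_curl_eq_zero`, countably many strips).

In words: **a local Leray solution whose final value vanishes on a half-space is trivial** — the
final value of a nontrivial local Leray solution is nonzero in every half-space `{x₃ > R}` (other
directions by the rotation covariance of the equations, not formalised here). Consumer: crux
`FiniteDissipationLiouville` (the final datum of a singular Type-I dissipation-law profile —
e.g. the homogeneous datum of a DSS blow-up — is nontrivial in every half-space `{x₃ > R}`).

## References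

* P. G. Lemarié-Rieusset, *The Navier–Stokes Problem in the 21st Century* (2016), Thm. 15.4.
  [`LemarieRieusset2016`]
* L. Escauriaza, G. Seregin, V. Šverák, Russ. Math. Surveys 58:2 (2003), §3, Thm. 5.1, §5.
  [`EscauriazaSereginSverak2003`]
* G. Seregin, Comm. Math. Phys. 312 (2012) 833–845, §4. [`Seregin2012CMP`]
-/

noncomputable section

open MeasureTheory TopologicalSpace Set Function Filter Metric
open _root_.Topology
open scoped ENNReal NNReal InnerProductSpace RealInnerProductSpace ContDiff

namespace Literature.Analysis.FluidPDE

/-! ### The direction `e₃` and a smooth step across the plane `{x₃ = R}` -/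

/-- The third coordinate vector `e₃` is a unit vector with `⟪x, e₃⟫ = x₃`. [folklore] -/
private theorem e3_norm_and_inner :
    ‖(EuclideanSpace.basisFun (Fin 3) ℝ 2 : EuclideanSpace ℝ (Fin 3))‖ = 1 ∧
      ∀ x : EuclideanSpace ℝ (Fin 3), ⟪x, EuclideanSpace.basisFun (Fin 3) ℝ 2⟫ = x 2 := by
  refine ⟨(EuclideanSpace.basisFun (Fin 3) ℝ).orthonormal.1 2, fun x => ?_⟩
  rw [EuclideanSpace.basisFun_apply, EuclideanSpace.inner_single_right]
  simp

/-- **A smooth step across the plane `{⟪x, e⟫ = R}`**: `σ(x) = smoothTransition (2 (⟪x, e⟫ − R) + 1)`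
is `C^∞`, equal to `1` on `{⟪x, e⟫ ≥ R}` and to `0` on `{⟪x, e⟫ ≤ R − 1/2}`; for a test field `φ`,
`σ • φ` is a test field. [folklore] -/
private theorem halfSpace_cutoff (e : EuclideanSpace ℝ (Fin 3)) (R : ℝ) :
    ∃ σ : EuclideanSpace ℝ (Fin 3) → ℝ, (∀ x : EuclideanSpace ℝ (Fin 3), R ≤ ⟪x, e⟫ → σ x = 1) ∧
      (∀ x : EuclideanSpace ℝ (Fin 3), σ x ≠ 0 → R - 1 / 2 < ⟪x, e⟫) ∧
      ∀ φ : EuclideanSpace ℝ (Fin 3) → EuclideanSpace ℝ (Fin 3),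
        FunctionSpaces.IsTestFunctionOn (⊤ : Opens (EuclideanSpace ℝ (Fin 3))) φ →
        FunctionSpaces.IsTestFunctionOn (⊤ : Opens (EuclideanSpace ℝ (Fin 3))) (fun x => σ x • φ x) := by
  have h1 : ContDiff ℝ ∞ (fun x : EuclideanSpace ℝ (Fin 3) => 2 * (⟪x, e⟫ - R) + 1) :=
    (contDiff_const.mul ((contDiff_id.inner ℝ contDiff_const).sub contDiff_const)).add
      contDiff_const
  refine ⟨fun x => Real.smoothTransition (2 * (⟪x, e⟫ - R) + 1), ?_, ?_, ?_⟩
  · intro x hx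
    exact Real.smoothTransition.one_of_one_le (by linarith)
  · intro x hx
    by_contra hle
    push Not at hle
    exact hx (Real.smoothTransition.zero_of_nonpos (by linarith))
  · intro φ hφ
    exact ⟨(Real.smoothTransition.contDiff.comp h1).smul hφ.contDiff,
      hφ.hasCompactSupport.mono fun x hx => right_ne_zero_of_smul hx, fun y _ => Opens.mem_top y⟩

/-! ### Steps 2–3 of the proof of Thm. 15.4 on a slab, final value vanishing on a half-space -/

/-- **The far-field vorticity of a local Leray solution whose final value vanishes on the
HALF-SPACE `{x₃ > R₁}` is zero (on a farther half-space)** (Lemarié-Rieusset 2016, proof of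
Thm. 15.4, Steps 2–3; Escauriaza–Seregin–Šverák 2003, §3 with Thm. 5.1): for a slab local Leray
solution `(u, p)` on `(0, T₁) × ℝ³`, viscosity `ν > 0`, weakly divergence-free datum, whose pairings
with the test fields SUPPORTED IN `{x₃ > R₁}` tend to `0` as `t ↑ T₁`, and every `T₄ ∈ (0, T₁)`,
there are `R` and a representative `U` of `u` on `(T₄, T₁) × {x₃ > R}`, `C¹` in space, with
`curl U(t, ·) = 0` there. [cite: LemarieRieusset2016, proof of Thm. 15.4, Steps 2–3 (PDF pp. 568–569)] [cite: EscauriazaSereginSverak2003, §3 (3.31)–(3.32) and Thm. 5.1] -/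
theorem localLeray_farField_curl_eq_zero_slab_of_halfSpace_vanishing
    (hB : NSBoundedHigherRegularityBounds) {ν T₁ : ℝ} (hν : 0 < ν)
    {u₀ : EuclideanSpace ℝ (Fin 3) → EuclideanSpace ℝ (Fin 3)}
    {u : ℝ → EuclideanSpace ℝ (Fin 3) → EuclideanSpace ℝ (Fin 3)}
    {p : ℝ → EuclideanSpace ℝ (Fin 3) → ℝ}
    (hdiv : IsWeaklyDivFree u₀) (hu : IsLocalLeraySolutionOn T₁ ν u₀ u p) {R₁ : ℝ}
    (hfinal : ∀ φ : EuclideanSpace ℝ (Fin 3) → EuclideanSpace ℝ (Fin 3),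
      FunctionSpaces.IsTestFunctionOn (⊤ : Opens (EuclideanSpace ℝ (Fin 3))) φ →
        (∀ x, φ x ≠ 0 → R₁ < x 2) →
        Tendsto (fun t => ∫ x, ⟪u t x, φ x⟫) (𝓝[<] T₁) (𝓝 0))
    {T₄ : ℝ} (hT₄ : T₄ ∈ Ioo 0 T₁) :
    ∃ (R : ℝ) (U : ℝ → EuclideanSpace ℝ (Fin 3) → EuclideanSpace ℝ (Fin 3)),
      (∀ t ∈ Ioo T₄ T₁, ContDiffOn ℝ 1 (U t) {x : EuclideanSpace ℝ (Fin 3) | R < x 2}) ∧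
        uncurry U =ᵐ[volume.restrict
          (Ioo T₄ T₁ ×ˢ {x : EuclideanSpace ℝ (Fin 3) | R < x 2})] uncurry u ∧
        ∀ t ∈ Ioo T₄ T₁, ∀ x : EuclideanSpace ℝ (Fin 3), R < x 2 → curl (U t) x = 0 := by
  obtain ⟨he, hinner⟩ := e3_norm_and_inner
  set e : EuclideanSpace ℝ (Fin 3) := EuclideanSpace.basisFun (Fin 3) ℝ 2 with hedef
  -- ### Step 2: the far-field bound and the far-field representative on the exterior of a ball
  have ht₁ : (0 : ℝ) < T₄ / 2 := by linarith [hT₄.1]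
  obtain ⟨R₀, hbd⟩ := hu.farField_bound_anyDatum hν ht₁ (le_refl T₁)
  set R : ℝ := max (max R₀ R₁) 0 + 1 with hRdef
  have hR₀R : R₀ < R := by
    rw [hRdef]; linarith [le_max_left R₀ R₁, le_max_left (max R₀ R₁) 0]
  have hR₁R : R₁ + 1 ≤ R := by
    rw [hRdef]; linarith [le_max_right R₀ R₁, le_max_left (max R₀ R₁) 0]
  have hR1 : (1 : ℝ) ≤ R := by rw [hRdef]; linarith [le_max_right (max R₀ R₁) 0]
  obtain ⟨K, U, hae, -, hCD, hjc, hbdK⟩ := exists_farField_representative hB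
    kangMiuraTsai_local_pressure_bound_holds hν hdiv hu ht₁ le_rfl hbd
    (by linarith [hT₄.1] : T₄ / 2 < T₄) hT₄.2 hR₀R 3
  -- the half-space `H = {x₃ > R} = {⟪x, e₃⟫ > R}` inside the exterior region
  set S : Set (EuclideanSpace ℝ (Fin 3)) := (closedBall (0 : EuclideanSpace ℝ (Fin 3)) R)ᶜ
    with hSdef
  set H : Set (EuclideanSpace ℝ (Fin 3)) := {x : EuclideanSpace ℝ (Fin 3) | R < ⟪x, e⟫} with hHdef
  have hHo : IsOpen H := isOpen_lt continuous_const (continuous_id.inner continuous_const)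
  have hcoord : ∀ x : EuclideanSpace ℝ (Fin 3), x 2 ≤ ‖x‖ := fun x => by
    have h := PiLp.norm_apply_le x (2 : Fin 3)
    rw [Real.norm_eq_abs] at h
    exact (le_abs_self _).trans h
  have hHS : H ⊆ S := fun x hx => by
    have hx' : R < ⟪x, e⟫ := hx
    rw [hinner] at hx'
    rw [hSdef, mem_compl_iff, mem_closedBall, dist_zero_right, not_le]
    exact lt_of_lt_of_le hx' (hcoord x)
  set Ω : Set (ℝ × EuclideanSpace ℝ (Fin 3)) := Ioo T₄ T₁ ×ˢ H with hΩdef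
  have hΩo : IsOpen Ω := isOpen_Ioo.prod hHo
  have hΩsub : Ω ⊆ Ioo T₄ T₁ ×ˢ S := prod_mono Subset.rfl hHS
  -- `(U, p)` solves the equations in `𝒟'(Ω)` with viscosity `ν`
  have hle : (⟨Ω, hΩo⟩ : Opens (ℝ × EuclideanSpace ℝ (Fin 3))) ≤
      slab (EuclideanSpace ℝ (Fin 3)) (Ioo 0 T₁) isOpen_Ioo := fun w hw =>
    mem_slab.2 ⟨hT₄.1.trans hw.1.1, hw.1.2⟩
  have haeΩ : uncurry U =ᵐ[volume.restrict Ω] uncurry u :=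
    ae_restrict_of_ae_restrict_of_subset hΩsub hae
  have hsolU : IsDistributionalNSSolutionOn ⟨Ω, hΩo⟩ ν 0 U p :=
    (hu.distributional.of_le hle).congr_ae haeΩ.symm (ae_of_all _ fun _ => rfl)
  -- ### the cut-off field `ũ = σ u`, `σ = 1` on `{x₃ ≥ R}`, `σ = 0` on `{x₃ ≤ R − 1/2}`
  obtain ⟨σ, hσ1, hσsupp, hσtest⟩ := halfSpace_cutoff e R
  set ut : ℝ → EuclideanSpace ℝ (Fin 3) → EuclideanSpace ℝ (Fin 3) :=
    fun t x => σ x • u t x with hutdef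
  have hae' : uncurry U =ᵐ[volume.restrict Ω] uncurry ut := by
    have hmem : ∀ᵐ z ∂(volume.restrict Ω), z ∈ Ω := ae_restrict_mem hΩo.measurableSet
    filter_upwards [haeΩ, hmem] with z hz hzΩ
    have hx : R < ⟪z.2, e⟫ := hzΩ.2
    rw [hz]
    show u z.1 z.2 = σ z.2 • u z.1 z.2
    rw [hσ1 z.2 hx.le, one_smul]
  have hfinal' : ∀ φ : EuclideanSpace ℝ (Fin 3) → EuclideanSpace ℝ (Fin 3),
      FunctionSpaces.IsTestFunctionOn (⊤ : Opens (EuclideanSpace ℝ (Fin 3))) φ →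
        Tendsto (fun t => ∫ x, ⟪ut t x, φ x⟫) (𝓝[<] T₁) (𝓝 0) := by
    intro φ hφ
    have hψfar : ∀ x, σ x • φ x ≠ 0 → R₁ < x 2 := fun x hx => by
      have h := hσsupp x (left_ne_zero_of_smul hx)
      rw [hinner] at h
      linarith
    refine (hfinal _ (hσtest φ hφ) hψfar).congr fun t => ?_
    refine integral_congr_ae (ae_of_all _ fun x => ?_)
    show ⟪u t x, σ x • φ x⟫ = ⟪σ x • u t x, φ x⟫
    rw [real_inner_smul_right, real_inner_smul_left]
  -- ### Step 3: the half-space frame theorem in the direction `e₃`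
  have hzero : ∀ t ∈ Ioo T₄ T₁, ∀ x : EuclideanSpace ℝ (Fin 3),
      R + Real.sqrt (ν * (T₁ - T₄)) < ⟪x, e⟫ → curl (U t) x = 0 :=
    farField_curl_eq_zero_halfSpace_of_frame he hν hT₄.2 hfinal' hae' hsolU
      (fun w hw => hCD w (hΩsub hw)) (fun n _ => (hjc n).mono hΩsub)
      (fun n hn w hw => hbdK n hn w (hΩsub hw))
  -- ### the farther half-space `{x₃ > R + √(ν (T₁ - T₄))}`
  have hγ : 0 ≤ Real.sqrt (ν * (T₁ - T₄)) := Real.sqrt_nonneg _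
  have hHof : ∀ x : EuclideanSpace ℝ (Fin 3), R + Real.sqrt (ν * (T₁ - T₄)) < x 2 → x ∈ H :=
    fun x hx => by
      show R < ⟪x, e⟫
      rw [hinner]
      linarith
  refine ⟨R + Real.sqrt (ν * (T₁ - T₄)), U, fun t ht => ?_, ?_, fun t ht x hx => ?_⟩
  · have hUS : ContDiffOn ℝ 1 (U t) S := fun x hx =>
      ((hCD (t, x) ⟨ht, hx⟩).of_le (by exact_mod_cast le_top)).contDiffWithinAt
    exact hUS.mono fun x hx => hHS (hHof x hx)
  · exact ae_restrict_of_ae_restrict_of_subset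
      (prod_mono Subset.rfl fun x hx => hHS (hHof x hx)) hae
  · exact hzero t ht x (by rw [hinner]; exact hx)

/-! ### Thm. 15.4 on a slab from one half-space of the final value -/

/-- **Backward uniqueness for slab local Leray solutions from ONE HALF-SPACE of the final value,
unit viscosity** (Lemarié-Rieusset 2016, Thm. 15.4, through Escauriaza–Seregin–Šverák 2003, §5:
the final value is required to vanish only on `{x₃ > R₁}`): a local Leray solution `(v, π)` on
`(0, T) × ℝ³` at unit viscosity with weakly divergence-free datum, whose pairings with the test
fields supported in `{x₃ > R₁}` tend to `0` as `t ↑ T`, vanishes a.e. on the slab.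
[cite: LemarieRieusset2016, Thm. 15.4 (PDF p. 568)] [cite: EscauriazaSereginSverak2003, §5] [cite: Seregin2012CMP, §4] -/
theorem IsLocalLeraySolutionOn.ae_zero_of_halfSpace_final_vanishing_unit {T : ℝ} (hT : 0 < T)
    {u₀ : EuclideanSpace ℝ (Fin 3) → EuclideanSpace ℝ (Fin 3)}
    {v : ℝ → EuclideanSpace ℝ (Fin 3) → EuclideanSpace ℝ (Fin 3)}
    {π : ℝ → EuclideanSpace ℝ (Fin 3) → ℝ}
    (hdiv : IsWeaklyDivFree u₀) (hv : IsLocalLeraySolutionOn T 1 u₀ v π) {R₁ : ℝ}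
    (hfinal : ∀ φ : EuclideanSpace ℝ (Fin 3) → EuclideanSpace ℝ (Fin 3),
      FunctionSpaces.IsTestFunctionOn (⊤ : Opens (EuclideanSpace ℝ (Fin 3))) φ →
        (∀ x, φ x ≠ 0 → R₁ < x 2) →
        Tendsto (fun t => ∫ x, ⟪v t x, φ x⟫) (𝓝[<] T) (𝓝 0)) :
    ∀ᵐ z ∂(volume.restrict (Ioo 0 T ×ˢ (univ : Set (EuclideanSpace ℝ (Fin 3))))),
      v z.1 z.2 = 0 := by
  -- it suffices to treat the slabs `(T₄, T) × ℝ³`, `T₄ = T/(n+2)`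
  suffices hmain : ∀ T₄ ∈ Ioo 0 T,
      ∀ᵐ z ∂(volume.restrict (Ioo T₄ T ×ˢ (univ : Set (EuclideanSpace ℝ (Fin 3))))),
        v z.1 z.2 = 0 by
    have hn : ∀ n : ℕ, ∀ᵐ z ∂(volume.restrict
        (Ioo (T / (n + 2)) T ×ˢ (univ : Set (EuclideanSpace ℝ (Fin 3))))), v z.1 z.2 = 0 :=
      fun n => hmain _ ⟨by positivity, div_lt_self hT (by norm_cast; omega)⟩
    have hU : Ioo 0 T ×ˢ (univ : Set (EuclideanSpace ℝ (Fin 3))) =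
        ⋃ n : ℕ, Ioo (T / (n + 2)) T ×ˢ (univ : Set (EuclideanSpace ℝ (Fin 3))) := by
      ext ⟨t, x⟩
      simp only [mem_prod, mem_Ioo, mem_univ, and_true, mem_iUnion]
      constructor
      · rintro ⟨ht0, htT⟩
        obtain ⟨n, hn⟩ := exists_nat_gt (T / t)
        refine ⟨n, ?_, htT⟩
        have h1 : T < (n : ℝ) * t := (div_lt_iff₀ ht0).1 hn
        rw [div_lt_iff₀ (by positivity)]
        nlinarith
      · rintro ⟨n, h1, h2⟩
        exact ⟨lt_trans (by positivity) h1, h2⟩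
    rw [hU, ae_restrict_iUnion_iff]
    exact hn
  intro T₄ hT₄
  have hI₄ : Ioo T₄ T ⊆ Ioo 0 T := Ioo_subset_Ioo hT₄.1.le le_rfl
  -- ### the far field: vanishing vorticity (Steps 2–3) and the `L^∞` bound
  obtain ⟨Rf, Uf, hUf1, hUfv, hcurl⟩ :=
    localLeray_farField_curl_eq_zero_slab_of_halfSpace_vanishing
      NSBoundedHigherRegularityBounds_holds one_pos hdiv hv hfinal hT₄
  obtain ⟨Rb, hRb⟩ :=
    hv.farField_bound_anyDatum one_pos hT₄.1 (le_refl T)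
  have hfar := ae_norm_le_toReal_of_eLpNorm_top_lt_top hRb
  -- ### a.e. time is regular; around each regular time a strip where `v` vanishes
  have hreg : ∀ᵐ t ∂(volume.restrict (Ioo T₄ T)), ∀ x : EuclideanSpace ℝ (Fin 3),
      IsRegularPoint v (t, x) :=
    ae_restrict_of_ae_restrict_of_subset hI₄ (ae_forall_isRegularPoint_slab one_pos hv.suitable)
  have hstrip : ∀ᵐ t ∂(volume.restrict (Ioo T₄ T)), ∃ q : ℚ × ℚ, t ∈ Ioo (q.1 : ℝ) q.2 ∧
      ∀ᵐ z ∂(volume.restrict (Ioo (q.1 : ℝ) q.2 ×ˢ (univ : Set (EuclideanSpace ℝ (Fin 3))))),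
        v z.1 z.2 = 0 := by
    filter_upwards [hreg, ae_restrict_mem measurableSet_Ioo] with t ht htI
    obtain ⟨τ, hτ, hsubτ, L, hL⟩ := exists_strip_bound_Ioo hfar (fun x _ => ht x) htI
    obtain ⟨h1, h2⟩ := (Ioo_subset_Ioo_iff (by linarith : t - τ < t + τ)).1 hsubτ
    -- the strip lemma on `(t - τ, t + τ/2)`, which vanishes on `(t - τ/4, t + τ/2) ∋ t`
    have ha : 0 < t - τ := lt_of_lt_of_le hT₄.1 h1
    have hab : t - τ < t + τ / 2 := by linarith
    have hbT : t + τ / 2 ≤ T := by linarith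
    have hJ : Ioo (t - τ) (t + τ / 2) ⊆ Ioo T₄ T := Ioo_subset_Ioo h1 (by linarith)
    have hbd : ∀ᵐ z ∂(volume.restrict
        (Ioo (t - τ) (t + τ / 2) ×ˢ (univ : Set (EuclideanSpace ℝ (Fin 3))))), ‖v z.1 z.2‖ ≤ L :=
      ae_restrict_of_ae_restrict_of_subset
        (prod_mono (Ioo_subset_Ioo le_rfl (by linarith)) Subset.rfl) hL
    have hz := ae_zero_strip_of_farField_curl_eq_zero NSBoundedHigherRegularityBounds_holds
      kangMiuraTsai_local_pressure_bound_holds hdiv hv ha hab hbT hbd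
      (fun s hs => hUf1 s (hJ hs))
      (ae_restrict_of_ae_restrict_of_subset (prod_mono hJ Subset.rfl) hUfv)
      (fun s hs x hx => hcurl s (hJ hs) x hx)
    obtain ⟨q₁, hq₁a, hq₁t⟩ := exists_rat_btwn (show t - τ / 4 < t by linarith)
    obtain ⟨q₂, hq₂t, hq₂b⟩ := exists_rat_btwn (show t < t + τ / 2 by linarith)
    refine ⟨(q₁, q₂), ⟨hq₁t, hq₂t⟩, ae_restrict_of_ae_restrict_of_subset (prod_mono
      (Ioo_subset_Ioo (by linarith) hq₂b.le) Subset.rfl) hz⟩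
  -- ### the countable union of the good rational strips carries a.e. every time
  set G : Set (ℚ × ℚ) := {q | ∀ᵐ z ∂(volume.restrict
    (Ioo (q.1 : ℝ) q.2 ×ˢ (univ : Set (EuclideanSpace ℝ (Fin 3))))), v z.1 z.2 = 0} with hG
  set S : Set ℝ := ⋃ q ∈ G, Ioo (q.1 : ℝ) q.2 with hSdef
  have hS : ∀ᵐ z ∂(volume.restrict (S ×ˢ (univ : Set (EuclideanSpace ℝ (Fin 3))))),
      v z.1 z.2 = 0 := by
    have e : S ×ˢ (univ : Set (EuclideanSpace ℝ (Fin 3))) =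
        ⋃ q ∈ G, Ioo (q.1 : ℝ) q.2 ×ˢ (univ : Set (EuclideanSpace ℝ (Fin 3))) := by
      rw [hSdef]
      simp only [iUnion_prod_const]
    rw [e, ae_restrict_biUnion_iff _ (Set.to_countable G)]
    exact fun q hq => hq
  have hnull : volume (Ioo T₄ T \ S) = 0 := by
    refine measure_eq_zero_iff_ae_notMem.2 ?_
    have h := (ae_restrict_iff' measurableSet_Ioo).1 hstrip
    filter_upwards [h] with t ht hmem
    obtain ⟨q, hq, hqG⟩ := ht hmem.1
    exact hmem.2 (mem_iUnion₂.2 ⟨q, hqG, hq⟩)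
  -- ### conclusion
  have hcover : Ioo T₄ T ×ˢ (univ : Set (EuclideanSpace ℝ (Fin 3))) ⊆
      S ×ˢ (univ : Set (EuclideanSpace ℝ (Fin 3))) ∪
        (Ioo T₄ T \ S) ×ˢ (univ : Set (EuclideanSpace ℝ (Fin 3))) := by
    rintro ⟨t, x⟩ ⟨ht, -⟩
    by_cases hts : t ∈ S
    · exact Or.inl ⟨hts, mem_univ _⟩
    · exact Or.inr ⟨⟨ht, hts⟩, mem_univ _⟩
  refine ae_restrict_of_ae_restrict_of_subset hcover ?_
  rw [ae_restrict_union_iff]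
  refine ⟨hS, ?_⟩
  have h0 : volume ((Ioo T₄ T \ S) ×ˢ (univ : Set (EuclideanSpace ℝ (Fin 3)))) = 0 := by
    rw [Measure.volume_eq_prod, Measure.prod_prod, hnull, zero_mul]
  rw [Measure.restrict_eq_zero.2 h0, ae_zero]
  exact eventually_bot

end Literature.Analysis.FluidPDE

end
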